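import Mathlib
import HarnessLib
import Literature.Analysis.FluidPDE.ClassicalSolution
import Literature.Analysis.FluidPDE.Vorticity
import Literature.Analysis.FluidPDE.TaoMainEstimateAnnulus

/-!
# Route `QuarterLogPincer`, crux `TypeIQuantSubcubicExp` (stmt-NavierStokesRegularity-24077), line `flat_chain` —
# transfer step 1 for S4′ `RegularBlockTransfer`: Tao's Gaussian lower bound (5.7) in BLOCK CURRENCY

Helper toward the registered stub S4′ `stub_regularBlockTransfer` of ns-idea-7 g14's skeleton
`Cruxes/TypeIQuantSubcubicExp/Lines/flat_chain.lean` (v1.2).  S4′ converts an EPOCH BLOCK (global `C¹` bounds for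
`u, ω` at scale `σ = s/D` on `[t₁ − 4σ, t₁ − σ]`) plus a CONCENTRATION BLOCK (`∫_{B(x₀,ρ√σ)}‖ω(t)‖² ≥ η σ^{-1/2}`
there) into cube mass at `t₁` via Tao's (5.7)ᵘ → (5.17) → (5.18).  This file is the first arrow, stated for the
space-translated field `v = u(·, x₀ + ·)` (centre `0`) on the UNFOLDED block hypotheses, so that it does not depend
on the line's definitions module:

* `blockGaussian_lower_bound` — for `Ce ≥ 1`, `η > 0` there is `E = E(Ce, η) > 0` such that, whenever `v` is
  classical on `[t₁ − 4σ, t₁ − σ]` with `‖v‖ ≤ Ce σ^{-1/2}`, `‖∇v‖, ‖ω‖ ≤ Ce σ⁻¹`, `‖∇ω‖ ≤ Ce σ^{-3/2}` there and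
  `η σ^{-1/2} ≤ ∫_{B(0,ρ√σ)}‖ω(t)‖²` there, then for every radius `R ≥ ρ√σ` with `σ ≤ R²`:
  `(η√σ/(4Ce²))·exp(−E R²/σ) ≤ ∫_{t₁−σ−σ/(4Ce²)}^{t₁−σ} ∫_{B(0,2R)∖B̄(0,R/2)} ‖ω‖² dx dt`.

Proof: the tree's `vorticity_gaussian_lower_bound_annulus_integral` (Tao 2021 (5.7), time-integrated, PROVED) on the
slab `[t' − T, t']`, `t' := t₁ − σ`, `T := σ/Ce²` (so that `Ce σ^{-1/2} = T^{-1/2}` is exactly Tao's normalisation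
(5.5), the vorticity constant is `M := 1`, the concentration is `δ := η σ^{-1/2}` at radius `ρ√σ`, and the
smallness `2K₀e^{-a} ≤ δ√T = η/Ce` holds for `a := K₀ + 2K₀Ce/η`); `E := 2K₀a³Ce²`.

HONEST FRAMING: bookkeeping around a PROVED tree theorem about HYPOTHETICAL classical solutions; one third of one
registered stub (S4′, size L); nothing here bears on the truth of ⟨24077⟩, W7 or Navier–Stokes regularity (OPEN /
not proved).  pub-ns-dss typer (g39), `--supports stmt-NavierStokesRegularity-24077`.
-/

set_option linter.dupNamespace false

noncomputable section

open MeasureTheory Set Function Metric Filter Topology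
open scoped ENNReal NNReal
open Literature.Analysis Literature.Analysis.FluidPDE

namespace Summit.NavierStokesRegularity.NavierStokesRegularity.Cruxes.TypeIQuantSubcubicExp.FlatChain

/-- `Ce σ^{-1/2} = (√(σ/Ce²))⁻¹` for `σ, Ce > 0`. -/
theorem mul_rpow_neg_half_eq_inv_sqrt {Ce σ : ℝ} (hCe : 0 < Ce) (hσ : 0 < σ) :
    Ce * σ ^ (-(1 / 2 : ℝ)) = (Real.sqrt (σ / Ce ^ 2))⁻¹ := by
  rw [Real.rpow_neg hσ.le, ← Real.sqrt_eq_rpow, Real.sqrt_div hσ.le, Real.sqrt_sq hCe.le]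
  field_simp

/-- **Tao's (5.7) in block currency** (see the module docstring).  [Tao2021QuantitativeNS Thm. 5.1 proof
p. 38 (5.7), via the tree's `vorticity_gaussian_lower_bound_annulus_integral`] -/
theorem blockGaussian_lower_bound (Ce η : ℝ) (hCe : 1 ≤ Ce) (hη : 0 < η) :
    ∃ E : ℝ, 0 < E ∧ ∀ ⦃t₁ σ ρ R : ℝ⦄ ⦃v : ℝ → EuclideanSpace ℝ (Fin 3) → EuclideanSpace ℝ (Fin 3)⦄
      ⦃q : ℝ → EuclideanSpace ℝ (Fin 3) → ℝ⦄,
      IsClassicalNSSolutionOn (Icc (t₁ - 4 * σ) (t₁ - σ)) 1 0 v q → 0 < σ → 0 < ρ →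
      (∀ t ∈ Icc (t₁ - 4 * σ) (t₁ - σ), ∀ x : EuclideanSpace ℝ (Fin 3),
        ‖v t x‖ ≤ Ce * σ ^ (-(1 / 2 : ℝ)) ∧ ‖fderiv ℝ (v t) x‖ ≤ Ce * σ⁻¹ ∧
          ‖vorticity v t x‖ ≤ Ce * σ⁻¹ ∧ ‖fderiv ℝ (vorticity v t) x‖ ≤ Ce * σ ^ (-(3 / 2 : ℝ))) →
      (∀ t ∈ Icc (t₁ - 4 * σ) (t₁ - σ),
        η * σ ^ (-(1 / 2 : ℝ)) ≤
          ∫ x in ball (0 : EuclideanSpace ℝ (Fin 3)) (ρ * Real.sqrt σ), ‖vorticity v t x‖ ^ 2) →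
      ρ * Real.sqrt σ ≤ R → σ ≤ R ^ 2 →
      η * Real.sqrt σ / (4 * Ce ^ 2) * Real.exp (-(E * R ^ 2 / σ)) ≤
        ∫ t in (t₁ - σ - σ / (4 * Ce ^ 2))..(t₁ - σ),
          ∫ x in ball (0 : EuclideanSpace ℝ (Fin 3)) (2 * R) \ closedBall 0 (R / 2),
            ‖vorticity v t x‖ ^ 2 := by
  obtain ⟨K₀, hK₀, hG⟩ := vorticity_gaussian_lower_bound_annulus_integral
  have hK₀pos : 0 < K₀ := by linarith
  have hCe0 : 0 < Ce := by linarith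
  -- the level separation of (5.7) and the Gaussian rate
  set L : ℝ := 2 * K₀ * Ce / η with hL
  have hLpos : 0 < L := by rw [hL]; positivity
  set a : ℝ := K₀ + L with ha
  have haK₀ : K₀ ≤ a := by rw [ha]; linarith
  have hapos : 0 < a := by linarith
  set E : ℝ := 2 * K₀ * a ^ 3 * Ce ^ 2 with hE
  have hEpos : 0 < E := by rw [hE]; positivity
  refine ⟨E, hEpos, ?_⟩
  intro t₁ σ ρ R v q hcl hσ hρ hbd hconc hρR hσR
  -- ### the Gaussian slab `[t' − T, t']`, `t' = t₁ − σ`, `T = σ/Ce²`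
  set T : ℝ := σ / Ce ^ 2 with hT
  have hTpos : 0 < T := by rw [hT]; positivity
  have hTσ : T ≤ σ := by
    rw [hT, div_le_iff₀ (by positivity)]
    have : σ * 1 ≤ σ * Ce ^ 2 := mul_le_mul_of_nonneg_left (by nlinarith) hσ.le
    linarith
  set t' : ℝ := t₁ - σ with ht'
  have hsub : Icc (t' - T) t' ⊆ Icc (t₁ - 4 * σ) (t₁ - σ) := by
    intro t ht
    exact ⟨by rw [ht'] at ht; linarith [ht.1], by rw [ht'] at ht; exact ht.2⟩
  have hcl' : IsClassicalNSSolutionOn (Icc (t' - T) t') 1 0 v q :=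
    hcl.mono hsub (uniqueDiffOn_Icc (by linarith))
  have hsT : 0 < Real.sqrt T := Real.sqrt_pos.2 hTpos
  have hsσ : 0 < Real.sqrt σ := Real.sqrt_pos.2 hσ
  -- the normalisation identities
  have hnorm0 : Ce * σ ^ (-(1 / 2 : ℝ)) = (Real.sqrt T)⁻¹ := by
    rw [hT]; exact mul_rpow_neg_half_eq_inv_sqrt hCe0 hσ
  have hTinv : T⁻¹ = Ce ^ 2 / σ := by rw [hT, inv_div]
  have hσinv_le : Ce * σ⁻¹ ≤ T⁻¹ := by
    rw [hTinv, div_eq_mul_inv]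
    refine mul_le_mul_of_nonneg_right ?_ (inv_nonneg.2 hσ.le)
    nlinarith
  have hsqrtT : Real.sqrt T = Real.sqrt σ / Ce := by
    rw [hT, Real.sqrt_div hσ.le, Real.sqrt_sq hCe0.le]
  have h32 : Ce * σ ^ (-(3 / 2 : ℝ)) ≤ 1 / (T * Real.sqrt T) := by
    -- `1/(T√T) = Ce³ σ^{-3/2}`
    have hσ32 : σ ^ (-(3 / 2 : ℝ)) = (σ * Real.sqrt σ)⁻¹ := by
      rw [Real.rpow_neg hσ.le, Real.sqrt_eq_rpow, ← Real.rpow_one_add' hσ.le (by norm_num)]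
      norm_num
    have hTT : T * Real.sqrt T = σ * Real.sqrt σ / Ce ^ 3 := by
      rw [hsqrtT, hT]; field_simp
    rw [hσ32, hTT, one_div_div, div_eq_mul_inv]
    refine mul_le_mul_of_nonneg_right ?_ (inv_nonneg.2 (by positivity))
    nlinarith
  -- ### (5.5): `|v| ≤ T^{-1/2}`, `|∇v| ≤ T⁻¹` on the slab
  have h55 : ∀ t ∈ Icc (t' - T) t', ∀ x : EuclideanSpace ℝ (Fin 3),
      ‖v t x‖ ≤ (Real.sqrt T)⁻¹ ∧ ‖fderiv ℝ (v t) x‖ ≤ T⁻¹ := by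
    intro t ht x
    obtain ⟨h0, h1, -, -⟩ := hbd t (hsub ht) x
    exact ⟨hnorm0 ▸ h0, h1.trans hσinv_le⟩
  -- ### (5.4) with `M := 1`: `|ω| ≤ 1/T`, `|∇ω| ≤ 1/(T√T)` on the slab
  have h54 : ∀ t ∈ Icc (t' - T) t', ∀ x : EuclideanSpace ℝ (Fin 3),
      ‖vorticity v t x‖ ≤ 1 / T ∧ ‖fderiv ℝ (vorticity v t) x‖ ≤ 1 / (T * Real.sqrt T) := by
    intro t ht x
    obtain ⟨-, -, h2, h3⟩ := hbd t (hsub ht) x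
    exact ⟨h2.trans (by rw [one_div]; exact hσinv_le), h3.trans h32⟩
  -- ### (5.6): the concentration on the slab
  have hδpos : 0 < η * σ ^ (-(1 / 2 : ℝ)) := mul_pos hη (Real.rpow_pos_of_pos hσ _)
  have hρ' : 0 < ρ * Real.sqrt σ := mul_pos hρ hsσ
  have h56 : ∀ t ∈ Icc (t' - T) t', η * σ ^ (-(1 / 2 : ℝ)) ≤
      ∫ x in ball (0 : EuclideanSpace ℝ (Fin 3)) (ρ * Real.sqrt σ), ‖vorticity v t x‖ ^ 2 :=
    fun t ht => hconc t (hsub ht)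
  -- ### the smallness `2K₀e^{-a} ≤ δ√T = η/Ce`
  have hδT : η * σ ^ (-(1 / 2 : ℝ)) * Real.sqrt T = η / Ce := by
    rw [hsqrtT, Real.rpow_neg hσ.le, ← Real.sqrt_eq_rpow]
    field_simp
  have hsmall : 2 * K₀ * (1 : ℝ) ^ 2 * Real.exp (-a) ≤ η * σ ^ (-(1 / 2 : ℝ)) * Real.sqrt T := by
    rw [hδT, one_pow, mul_one]
    have h1 : Real.exp (-a) ≤ 1 / L := by
      rw [Real.exp_neg, inv_eq_one_div]
      have h2 : L ≤ Real.exp a := by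
        calc L ≤ a + 1 := by rw [ha]; linarith
          _ ≤ Real.exp a := Real.add_one_le_exp a
      exact one_div_le_one_div_of_le hLpos h2
    calc 2 * K₀ * Real.exp (-a) ≤ 2 * K₀ * (1 / L) := mul_le_mul_of_nonneg_left h1 (by positivity)
      _ = η / Ce := by rw [hL]; field_simp
  -- ### apply (5.7)
  have hTR : T ≤ R ^ 2 := hTσ.trans hσR
  have hmain := hG hcl' hTpos haK₀ le_rfl hδpos hρ' hρR hTR h55 h54 h56 hsmall
  -- ### rewrite into block currency
  have hpre : T / 4 * (η * σ ^ (-(1 / 2 : ℝ)) * Real.exp (-(2 * K₀ * a ^ 3 * R ^ 2 / T))) =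
      η * Real.sqrt σ / (4 * Ce ^ 2) * Real.exp (-(E * R ^ 2 / σ)) := by
    have hexp : 2 * K₀ * a ^ 3 * R ^ 2 / T = E * R ^ 2 / σ := by
      rw [hE, hT]; field_simp
    have hfac : T / 4 * (η * σ ^ (-(1 / 2 : ℝ))) = η * Real.sqrt σ / (4 * Ce ^ 2) := by
      rw [hT, Real.rpow_neg hσ.le, ← Real.sqrt_eq_rpow]
      have hσs : σ * (Real.sqrt σ)⁻¹ = Real.sqrt σ := by
        rw [mul_inv_eq_iff_eq_mul₀ hsσ.ne', Real.mul_self_sqrt hσ.le]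
      calc σ / Ce ^ 2 / 4 * (η * (Real.sqrt σ)⁻¹)
          = η / (4 * Ce ^ 2) * (σ * (Real.sqrt σ)⁻¹) := by ring
        _ = η / (4 * Ce ^ 2) * Real.sqrt σ := by rw [hσs]
        _ = η * Real.sqrt σ / (4 * Ce ^ 2) := by ring
    rw [hexp, ← mul_assoc, hfac]
  have hwin : t' - T / 4 = t₁ - σ - σ / (4 * Ce ^ 2) := by
    rw [ht', hT]; ring
  rw [hpre, hwin] at hmain
  exact hmain

end Summit.NavierStokesRegularity.NavierStokesRegularity.Cruxes.TypeIQuantSubcubicExp.FlatChain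

end
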